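import Summits.QuantumFields.YangMills.Theorems.SwapVirialDeficitSectorLaplaceTipCornerIntegrals
import Summits.QuantumFields.YangMills.Theorems.SwapVirialDeficitSectorLaplaceTipMidShellIntegration
import HarnessLib

/-!
# THE TIP OF SKELETON ➎, CORNER LAYER: the corner disc `|p| < ρ₀` of the tip against the shell from a `p`-DEPENDENT pointwise law (layer 2 of the tip plug)
# (cell ym-idea-1; free-hands support of ⟨stmt-QuantumFields-24197⟩ `SwapVirialDeficit.SwapGluedStiffness`; g49 2026-09-01 00:57Z; twin of w3 g68's
# ✓`tipMid_le_shell_of_pointwise` with the structured-floor weight `(1+δt²)²/(1 + κ|p|²(1+δt²))` and an oscillation average on the shell)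

On the corner disc the sandwich constant is `p`-dependent: `𝔪_t(δt,p)·δs·(1 + κ|p|²(1+δt²)) ≤ R·(1+δt²)²·𝔪_s(δs,p)` (both terms of the structured floor
`det M ≥ α_uα_v + c_r(…)`).  The `p`-integral over the disc is explicit (✓`setIntegral_disc_inv_one_add_mul_le`, decay `1/(κ(1+δt²))` up to `arsinh²`), the
shell value at `p` is moved to the shell's average over a reference set `A′` by an oscillation bound, and the `δt`-integral against `((1+δt²)⁻¹)²` converges for
EVERY core cut (✓`integral_Ioi_inv_one_add_sq_mul_rpow_le`, rate `δ₁^{−3/4} ≍ τ^{3/8}`):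
* `setIntegral_disc_le_of_pointwise` — the per-`δt` disc integral;
* ★★ `corner_le_shell_of_pointwise` — abstract `δ`-densities;
* ★★ `tipCorner_le_shell_of_pointwise` — the Morse–Bott plane mass: `∫_{Mid} ((1+δ²)⁻¹)²·∫_{|p|<ρ₀} 𝔪(hubAt δ 1) ≤ Cc·∫_{Icc a c} ((1+δ²)⁻¹)²·∫_{Box} 𝔪(hubAt δ 1)`,
  `Cc = 256·R·Osc·(1+2√κ·ρ₀)^{1/4}/(κ·V) · (8/3)·δ₁^{−3/4} / W`, `W = ((1+a²)⁻¹ − (1+c²)⁻¹)/2`, `V ≤ vol(A′)`, `A′ ⊆ Box`.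
SOCKETS for w2 g61 (pointwise, `p.1²+p.2² < ρ₀²`, `δt ∈ Mid`, `δs ∈ Icc a c`): (hC) the corner comparability above; (hOsc) `𝔪(hubAt δs 1) ε p ≤ Osc·𝔪(hubAt δs 1) ε p′` for `p′ ∈ A′`.

HONEST LABEL: integration bookkeeping; the pointwise sockets, `stub_core_tip`, ⟨24197⟩ ∕ ⟨24194⟩ are OPEN; item of record ⟨24085⟩ `SubOctaveBounded` aside ∕ untouched; the
Yang–Mills mass gap is NOT proved; no summit is proved by a line.  THEOREMS ONLY (0 `def`, 0 `sorry`), standard axioms, no instances.  Seat ym-line-fcl-p3 g49 (cell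
ym-idea-1, free hands = ➎ assembler), `--supports stmt-QuantumFields-24197`.  References: [folklore]; [cite: Luscher1983, §2].
-/

set_option autoImplicit false
set_option synthInstance.maxSize 1024

noncomputable section

open MeasureTheory Quaternion Set Module
open scoped Quaternion BigOperators ENNReal
open Literature.MathematicalPhysics.QuantumLattice
open Literature.MathematicalPhysics.QuantumFieldTheory hiding SU2
open Summit.QuantumFields.YangMills.Theorems.SwapTwistDeficit.ToronLog

namespace Summit.QuantumFields.YangMills.Theorems.SwapVirialDeficit.SectorLaplace

open Summit.QuantumFields.YangMills.Theorems.FemtoTransferGap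
open Summit.QuantumFields.YangMills.Theorems.FemtoTransferGap.TT
open Summit.QuantumFields.YangMills.Theorems.VirialFluxGap.RingDeficit
open Summit.QuantumFields.YangMills.Theorems.SwapVirialDeficit.SwapRing
open Summit.QuantumFields.YangMills.Theorems.SwapVirialDeficit.BlowUpRing

variable {L : ℕ} [NeZero L]

/-! ## §1 The per-`δt` disc integral -/

omit [NeZero L] in
/-- ★ **THE DISC INTEGRAL OF A `p`-DEPENDENT CEILING**: if `f p · (1 + κ|p|²T) ≤ M` on the disc `|p|² < ρ₀²` (`κ, T > 0`, `M, ρ₀ ≥ 0`), then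
`∫_{disc} f ≤ M · 256·(1 + 2√κρ₀)^{1/4}·T^{1/8}/(κ T)` whenever `1 ≤ T` (✓`setIntegral_disc_inv_one_add_mul_le`, ✓`arsinh_sq_le_rpow`; if `f` is not integrable on
the disc its Bochner integral is `0`). [folklore] -/
theorem setIntegral_disc_le_of_pointwise {f : ℝ × ℝ → ℝ} {κ T M ρ₀ : ℝ} (hκ : 0 < κ) (hT : 1 ≤ T) (hM : 0 ≤ M) (hρ₀ : 0 ≤ ρ₀)
    (hf : ∀ p : ℝ × ℝ, p.1 ^ 2 + p.2 ^ 2 < ρ₀ ^ 2 → f p * (1 + κ * (p.1 ^ 2 + p.2 ^ 2) * T) ≤ M) :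
    ∫ p in {p : ℝ × ℝ | p.1 ^ 2 + p.2 ^ 2 < ρ₀ ^ 2}, f p ≤ M * (256 * (1 + 2 * Real.sqrt κ * ρ₀) ^ (1 / 4 : ℝ) * T ^ (1 / 8 : ℝ) / (κ * T)) := by
  have hT0 : 0 < T := by linarith
  have hc : 0 < κ * T := mul_pos hκ hT0
  set D : Set (ℝ × ℝ) := {p : ℝ × ℝ | p.1 ^ 2 + p.2 ^ 2 < ρ₀ ^ 2} with hD
  have hDm : MeasurableSet D := by
    rw [hD]; exact measurableSet_lt (by fun_prop) measurable_const
  -- the explicit disc integral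
  have hdisc := setIntegral_disc_inv_one_add_mul_le hc hρ₀
  have hars : (2 * Real.arsinh (Real.sqrt (κ * T) * ρ₀) / Real.sqrt (κ * T)) ^ 2 ≤ 256 * (1 + 2 * Real.sqrt κ * ρ₀) ^ (1 / 4 : ℝ) * T ^ (1 / 8 : ℝ) / (κ * T) := by
    have hz : 0 ≤ Real.sqrt (κ * T) * ρ₀ := by positivity
    have h1 := arsinh_sq_le_rpow hz
    have hsq : Real.sqrt (κ * T) ^ 2 = κ * T := Real.sq_sqrt hc.le
    rw [div_pow, mul_pow, hsq]
    -- `(1 + 2√(κT)ρ₀)^{1/4} ≤ (1 + 2√κρ₀)^{1/4}·T^{1/8}`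
    have hsT : Real.sqrt (κ * T) = Real.sqrt κ * Real.sqrt T := Real.sqrt_mul hκ.le T
    have hT1 : 1 ≤ Real.sqrt T := Real.one_le_sqrt.2 hT
    have hin : 1 + 2 * (Real.sqrt (κ * T) * ρ₀) ≤ (1 + 2 * Real.sqrt κ * ρ₀) * Real.sqrt T := by
      rw [hsT]; nlinarith [mul_nonneg (mul_nonneg (Real.sqrt_nonneg κ) hρ₀) (sub_nonneg.2 hT1), Real.sqrt_nonneg κ]
    have h2 : (1 + 2 * (Real.sqrt (κ * T) * ρ₀)) ^ (1 / 4 : ℝ) ≤ ((1 + 2 * Real.sqrt κ * ρ₀) * Real.sqrt T) ^ (1 / 4 : ℝ) :=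
      Real.rpow_le_rpow (by positivity) hin (by norm_num)
    have hsq4 : Real.sqrt T ^ (1 / 4 : ℝ) = T ^ (1 / 8 : ℝ) := by
      rw [Real.sqrt_eq_rpow, ← Real.rpow_mul hT0.le]; norm_num
    have h3 : ((1 + 2 * Real.sqrt κ * ρ₀) * Real.sqrt T) ^ (1 / 4 : ℝ) = (1 + 2 * Real.sqrt κ * ρ₀) ^ (1 / 4 : ℝ) * T ^ (1 / 8 : ℝ) := by
      rw [Real.mul_rpow (by positivity) (Real.sqrt_nonneg _), hsq4]
    have h4 : Real.arsinh (Real.sqrt (κ * T) * ρ₀) ^ 2 ≤ 64 * ((1 + 2 * Real.sqrt κ * ρ₀) ^ (1 / 4 : ℝ) * T ^ (1 / 8 : ℝ)) := by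
      have h5 := h2.trans h3.le
      exact h1.trans (by nlinarith)
    exact div_le_div_of_nonneg_right (by nlinarith [h4]) hc.le
  -- compare `f ≤ M·(1+κT|p|²)⁻¹` on the disc
  by_cases hfi : IntegrableOn f D
  · have hbound : IntegrableOn (fun p : ℝ × ℝ => M * (1 + κ * T * (p.1 ^ 2 + p.2 ^ 2))⁻¹) D := by
      have hfin : volume (Icc (-ρ₀) ρ₀ ×ˢ Icc (-ρ₀) ρ₀) < ⊤ := by
        rw [Measure.volume_eq_prod, Measure.prod_prod]; exact ENNReal.mul_lt_top measure_Icc_lt_top measure_Icc_lt_top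
      have hDfin : volume D < ⊤ := lt_of_le_of_lt (measure_mono (disc_subset_square hρ₀)) hfin
      have hconst : IntegrableOn (fun _ : ℝ × ℝ => M) D := (integrableOn_const_iff (by simp)).2 (Or.inr hDfin)
      refine Integrable.mono' hconst (by fun_prop : Measurable fun p : ℝ × ℝ => M * (1 + κ * T * (p.1 ^ 2 + p.2 ^ 2))⁻¹).aestronglyMeasurable
        (Filter.Eventually.of_forall fun p => ?_)
      rw [Real.norm_eq_abs, abs_of_nonneg (by positivity)]
      have h1 : (1 + κ * T * (p.1 ^ 2 + p.2 ^ 2))⁻¹ ≤ 1 := inv_le_one_of_one_le₀ (by nlinarith [sq_nonneg p.1, sq_nonneg p.2, hc.le])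
      nlinarith
    have hpt : ∀ p ∈ D, f p ≤ M * (1 + κ * T * (p.1 ^ 2 + p.2 ^ 2))⁻¹ := by
      intro p hp
      have hq : 0 < 1 + κ * T * (p.1 ^ 2 + p.2 ^ 2) := by positivity
      rw [← div_eq_mul_inv, le_div_iff₀ hq]
      have := hf p hp
      nlinarith
    calc ∫ p in D, f p ≤ ∫ p in D, M * (1 + κ * T * (p.1 ^ 2 + p.2 ^ 2))⁻¹ := setIntegral_mono_on hfi hbound hDm hpt
      _ = M * ∫ p in D, (1 + κ * T * (p.1 ^ 2 + p.2 ^ 2))⁻¹ := integral_const_mul _ _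
      _ ≤ M * (2 * Real.arsinh (Real.sqrt (κ * T) * ρ₀) / Real.sqrt (κ * T)) ^ 2 := mul_le_mul_of_nonneg_left hdisc hM
      _ ≤ _ := mul_le_mul_of_nonneg_left hars hM
  · rw [integral_undef hfi]
    positivity

/-! ## §2 ★★ The corner layer for the Morse–Bott plane mass -/

set_option maxHeartbeats 800000 in
/-- ★★ **THE CORNER DISC OF THE TIP AGAINST THE SHELL from the `p`-dependent sandwich (hC) and the shell oscillation (hOsc).**  Windows `Mid ⊆ Ioi δ₁`
(`δ₁ > 0`, measurable), shell letters `Icc a c` (`0 < a < c`), a set `Box ⊇ A′` (`A′` measurable) with `0 < V ≤ vol(A′) < ∞`, constants `κ > 0`, `R, Osc, ρ₀ ≥ 0`;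
(hC): `𝔪(hubAt δt 1,ε,p)·δs·(1 + κ|p|²(1+δt²)) ≤ R·(1+δt²)²·𝔪(hubAt δs 1,ε,p)` on the disc `|p|² < ρ₀²`; (hOsc): `𝔪(hubAt δs 1,ε,p) ≤ Osc·𝔪(hubAt δs 1,ε,p′)`
for `p` in the disc, `p′ ∈ A′`; integrability along the shell.  Then
`∫_{Mid} ((1+δ²)⁻¹)²·∫_{disc} 𝔪(hubAt δ 1) ≤ (256·R·Osc·(1+2√κρ₀)^{1/4}/(κV))/W · (4/3)·δ₁^{−3/4} · ∫_{Icc a c} ((1+δ²)⁻¹)²·∫_{Box} 𝔪(hubAt δ 1)`,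
`W = ((1+a²)⁻¹ − (1+c²)⁻¹)/2` — valid for EVERY `Mid` (no core cut enters), rate `δ₁^{−3/4} ≍ τ^{3/8}`. [folklore] -/
theorem tipCorner_le_shell_of_pointwise (ε : GnoSign L) {Mid : Set ℝ} (hMid : MeasurableSet Mid) {δ₁ : ℝ} (hδ₁ : 0 < δ₁) (hMid₁ : Mid ⊆ Ioi δ₁)
    {a c : ℝ} (ha : 0 < a) (hac : a < c) {Box A' : Set (ℝ × ℝ)} (hA' : MeasurableSet A') (hA'B : A' ⊆ Box)
    (hA'fin : volume A' < ⊤) {V : ℝ} (hV : 0 < V) (hVA : V ≤ volume.real A')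
    {κ R Osc ρ₀ : ℝ} (hκ : 0 < κ) (hR : 0 ≤ R) (hOsc0 : 0 ≤ Osc) (hρ₀ : 0 ≤ ρ₀)
    (H : ∀ δt ∈ Mid, ∀ δs ∈ Icc a c, ∀ p : ℝ × ℝ, p.1 ^ 2 + p.2 ^ 2 < ρ₀ ^ 2 →
      mbDensity (L := L) (hubAt δt 1) ε p * δs * (1 + κ * (p.1 ^ 2 + p.2 ^ 2) * (1 + δt ^ 2)) ≤ R * (1 + δt ^ 2) ^ 2 * mbDensity (L := L) (hubAt δs 1) ε p)
    (hOsc : ∀ δs ∈ Icc a c, ∀ p : ℝ × ℝ, p.1 ^ 2 + p.2 ^ 2 < ρ₀ ^ 2 → ∀ p' ∈ A', mbDensity (L := L) (hubAt δs 1) ε p ≤ Osc * mbDensity (L := L) (hubAt δs 1) ε p')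
    (hInt : ∀ δs ∈ Icc a c, IntegrableOn (fun p : ℝ × ℝ => mbDensity (L := L) (hubAt δs 1) ε p) Box)
    (hS : IntegrableOn (fun δ : ℝ => ((1 + δ ^ 2)⁻¹) ^ 2 * ∫ p in Box, mbDensity (L := L) (hubAt δ 1) ε p) (Icc a c)) :
    ∫ δ in Mid, ((1 + δ ^ 2)⁻¹) ^ 2 * ∫ p in {p : ℝ × ℝ | p.1 ^ 2 + p.2 ^ 2 < ρ₀ ^ 2}, mbDensity (L := L) (hubAt δ 1) ε p ≤
      (256 * R * Osc * (1 + 2 * Real.sqrt κ * ρ₀) ^ (1 / 4 : ℝ) / (κ * V)) / (((1 + a ^ 2)⁻¹ - (1 + c ^ 2)⁻¹) / 2) * ((4 / 3) * δ₁ ^ (-(3 / 4 : ℝ))) *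
        ∫ δ in Icc a c, ((1 + δ ^ 2)⁻¹) ^ 2 * ∫ p in Box, mbDensity (L := L) (hubAt δ 1) ε p := by
  have hδ₁0 : 0 < δ₁ := hδ₁
  set D : Set (ℝ × ℝ) := {p : ℝ × ℝ | p.1 ^ 2 + p.2 ^ 2 < ρ₀ ^ 2} with hD
  set W : ℝ := ((1 + a ^ 2)⁻¹ - (1 + c ^ 2)⁻¹) / 2 with hW
  set G : ℝ → ℝ := fun δs => ∫ p in Box, mbDensity (L := L) (hubAt δs 1) ε p with hG
  set B : ℝ := ∫ δ in Icc a c, ((1 + δ ^ 2)⁻¹) ^ 2 * G δ with hB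
  set ω : ℝ := 256 * R * Osc * (1 + 2 * Real.sqrt κ * ρ₀) ^ (1 / 4 : ℝ) / (κ * V) with hω
  have hW0 : 0 < W := by
    rw [hW]
    have h : (1 + c ^ 2)⁻¹ < (1 + a ^ 2)⁻¹ := by
      apply inv_strictAnti₀ (by positivity)
      nlinarith [mul_pos ha (by linarith : (0 : ℝ) < c)]
    linarith
  have hG0 : ∀ δ, 0 ≤ G δ := fun δ => by rw [hG]; exact integral_nonneg fun p => mbDensity_nonneg _ ε p
  have hB0 : 0 ≤ B := by rw [hB]; exact setIntegral_nonneg measurableSet_Icc fun δ _ => mul_nonneg (by positivity) (hG0 δ)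
  have hX0 : 0 ≤ (1 + 2 * Real.sqrt κ * ρ₀) ^ (1 / 4 : ℝ) := Real.rpow_nonneg (by positivity) _
  have hω0 : 0 ≤ ω := by rw [hω]; positivity
  -- Step A: the shell value at a corner point is at most `Osc/V` times the shell box integral
  have hA : ∀ δs ∈ Icc a c, ∀ p : ℝ × ℝ, p.1 ^ 2 + p.2 ^ 2 < ρ₀ ^ 2 → mbDensity (L := L) (hubAt δs 1) ε p * V ≤ Osc * G δs := by
    intro δs hδs p hp
    have hm0 : 0 ≤ mbDensity (L := L) (hubAt δs 1) ε p := mbDensity_nonneg _ ε p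
    have hIA : IntegrableOn (fun p' : ℝ × ℝ => mbDensity (L := L) (hubAt δs 1) ε p') A' := (hInt δs hδs).mono_set hA'B
    have hconst : IntegrableOn (fun _ : ℝ × ℝ => mbDensity (L := L) (hubAt δs 1) ε p) A' := (integrableOn_const_iff (by simp)).2 (Or.inr hA'fin)
    have h1 : ∫ _ in A', mbDensity (L := L) (hubAt δs 1) ε p ≤ ∫ p' in A', Osc * mbDensity (L := L) (hubAt δs 1) ε p' :=
      setIntegral_mono_on hconst (hIA.const_mul Osc) hA' (fun p' hp' => hOsc δs hδs p hp p' hp')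
    rw [setIntegral_const, smul_eq_mul, integral_const_mul] at h1
    have h2 : ∫ p' in A', mbDensity (L := L) (hubAt δs 1) ε p' ≤ G δs := by
      rw [hG]; exact setIntegral_mono_set (hInt δs hδs) (Filter.Eventually.of_forall fun p => mbDensity_nonneg _ ε p) (Filter.Eventually.of_forall hA'B)
    calc mbDensity (L := L) (hubAt δs 1) ε p * V ≤ mbDensity (L := L) (hubAt δs 1) ε p * volume.real A' := mul_le_mul_of_nonneg_left hVA hm0
      _ = volume.real A' * mbDensity (L := L) (hubAt δs 1) ε p := mul_comm _ _
      _ ≤ Osc * ∫ p' in A', mbDensity (L := L) (hubAt δs 1) ε p' := h1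
      _ ≤ Osc * G δs := mul_le_mul_of_nonneg_left h2 hOsc0
  -- Step B: the disc integral per tip letter
  have hBstep : ∀ δt ∈ Mid, ∀ δs ∈ Icc a c,
      (∫ p in D, mbDensity (L := L) (hubAt δt 1) ε p) * δs ≤ ω * ((1 + δt ^ 2) * (1 + δt ^ 2) ^ (1 / 8 : ℝ)) * G δs := by
    intro δt hδt δs hδs
    have hδs0 : 0 < δs := lt_of_lt_of_le ha hδs.1
    have hT : (1 : ℝ) ≤ 1 + δt ^ 2 := by nlinarith [sq_nonneg δt]
    have hT0 : 0 < 1 + δt ^ 2 := by positivity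
    -- the pointwise ceiling with `M = R·T²·Osc·G/(δs·V)`
    have hM0 : 0 ≤ R * (1 + δt ^ 2) ^ 2 * (Osc * G δs) / (δs * V) := div_nonneg (mul_nonneg (by positivity) (mul_nonneg hOsc0 (hG0 δs))) (by positivity)
    have hpt : ∀ p : ℝ × ℝ, p.1 ^ 2 + p.2 ^ 2 < ρ₀ ^ 2 →
        mbDensity (L := L) (hubAt δt 1) ε p * (1 + κ * (p.1 ^ 2 + p.2 ^ 2) * (1 + δt ^ 2)) ≤ R * (1 + δt ^ 2) ^ 2 * (Osc * G δs) / (δs * V) := by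
      intro p hp
      rw [le_div_iff₀ (by positivity)]
      have h1 := H δt hδt δs hδs p hp
      have h2 := hA δs hδs p hp
      have h3 : 0 ≤ R * (1 + δt ^ 2) ^ 2 := by positivity
      calc mbDensity (L := L) (hubAt δt 1) ε p * (1 + κ * (p.1 ^ 2 + p.2 ^ 2) * (1 + δt ^ 2)) * (δs * V)
          = (mbDensity (L := L) (hubAt δt 1) ε p * δs * (1 + κ * (p.1 ^ 2 + p.2 ^ 2) * (1 + δt ^ 2))) * V := by ring
        _ ≤ (R * (1 + δt ^ 2) ^ 2 * mbDensity (L := L) (hubAt δs 1) ε p) * V := mul_le_mul_of_nonneg_right h1 hV.le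
        _ = R * (1 + δt ^ 2) ^ 2 * (mbDensity (L := L) (hubAt δs 1) ε p * V) := by ring
        _ ≤ R * (1 + δt ^ 2) ^ 2 * (Osc * G δs) := mul_le_mul_of_nonneg_left h2 h3
    have hdisc := setIntegral_disc_le_of_pointwise (f := fun p : ℝ × ℝ => mbDensity (L := L) (hubAt δt 1) ε p) hκ hT hM0 hρ₀ hpt
    have hne : κ * (1 + δt ^ 2) ≠ 0 := by positivity
    calc (∫ p in D, mbDensity (L := L) (hubAt δt 1) ε p) * δs
        ≤ (R * (1 + δt ^ 2) ^ 2 * (Osc * G δs) / (δs * V) *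
            (256 * (1 + 2 * Real.sqrt κ * ρ₀) ^ (1 / 4 : ℝ) * (1 + δt ^ 2) ^ (1 / 8 : ℝ) / (κ * (1 + δt ^ 2)))) * δs := mul_le_mul_of_nonneg_right hdisc hδs0.le
      _ = ω * ((1 + δt ^ 2) * (1 + δt ^ 2) ^ (1 / 8 : ℝ)) * G δs := by
          rw [hω]; field_simp
  -- Step C: average over the shell letter against `δs·((1+δs²)⁻¹)²` (as in ✓`integral_mid_le_shell_of_pointwise`)
  have hCstep : ∀ δt ∈ Mid, ((1 + δt ^ 2)⁻¹) ^ 2 * (∫ p in D, mbDensity (L := L) (hubAt δt 1) ε p) * W ≤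
      ω * ((1 + δt ^ 2)⁻¹ * (1 + δt ^ 2) ^ (1 / 8 : ℝ)) * B := by
    intro δt hδt
    have hT0 : 0 < 1 + δt ^ 2 := by positivity
    set F : ℝ := ∫ p in D, mbDensity (L := L) (hubAt δt 1) ε p with hF
    have hF0 : 0 ≤ F := by rw [hF]; exact integral_nonneg fun p => mbDensity_nonneg _ ε p
    have hpt : ∀ δs ∈ Icc a c, ((1 + δt ^ 2)⁻¹) ^ 2 * F * (δs * ((1 + δs ^ 2)⁻¹) ^ 2) ≤
        ω * ((1 + δt ^ 2)⁻¹ * (1 + δt ^ 2) ^ (1 / 8 : ℝ)) * (((1 + δs ^ 2)⁻¹) ^ 2 * G δs) := by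
      intro δs hδs
      have h := hBstep δt hδt δs hδs
      have hw : 0 ≤ ((1 + δs ^ 2)⁻¹) ^ 2 := by positivity
      have e1 : ((1 + δt ^ 2)⁻¹) ^ 2 * F * (δs * ((1 + δs ^ 2)⁻¹) ^ 2) = ((1 + δt ^ 2)⁻¹) ^ 2 * ((1 + δs ^ 2)⁻¹) ^ 2 * (F * δs) := by ring
      have e2 : ω * ((1 + δt ^ 2)⁻¹ * (1 + δt ^ 2) ^ (1 / 8 : ℝ)) * (((1 + δs ^ 2)⁻¹) ^ 2 * G δs) =
          ((1 + δt ^ 2)⁻¹) ^ 2 * ((1 + δs ^ 2)⁻¹) ^ 2 * (ω * ((1 + δt ^ 2) * (1 + δt ^ 2) ^ (1 / 8 : ℝ)) * G δs) := by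
        field_simp
      rw [e1, e2]
      exact mul_le_mul_of_nonneg_left h (by positivity)
    have hinv : Continuous fun x : ℝ => (1 + x ^ 2)⁻¹ :=
      Continuous.inv₀ (f := fun x : ℝ => 1 + x ^ 2) (by fun_prop) (fun x => by show (1 + x ^ 2 : ℝ) ≠ 0; positivity)
    have hintL : IntegrableOn (fun δs : ℝ => ((1 + δt ^ 2)⁻¹) ^ 2 * F * (δs * ((1 + δs ^ 2)⁻¹) ^ 2)) (Icc a c) :=
      (continuous_const.mul (continuous_id.mul (hinv.pow 2))).integrableOn_Icc
    have hS' : IntegrableOn (fun δs : ℝ => ((1 + δs ^ 2)⁻¹) ^ 2 * G δs) (Icc a c) := by rw [hG]; exact hS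
    have hintR : IntegrableOn (fun δs : ℝ => ω * ((1 + δt ^ 2)⁻¹ * (1 + δt ^ 2) ^ (1 / 8 : ℝ)) * (((1 + δs ^ 2)⁻¹) ^ 2 * G δs)) (Icc a c) :=
      hS'.const_mul _
    have hmono := setIntegral_mono_on hintL hintR measurableSet_Icc hpt
    rw [integral_const_mul, integral_const_mul, integral_Icc_mul_inv_one_add_sq_sq hac.le] at hmono
    rw [hB]
    exact hmono
  -- Step D: integrate the tip letter over `Mid ⊆ Ioi δ₁` against `δ^{−7/4}`
  have hpt2 : ∀ δt ∈ Mid, ((1 + δt ^ 2)⁻¹) ^ 2 * ∫ p in D, mbDensity (L := L) (hubAt δt 1) ε p ≤ (ω * B / W) * δt ^ (-(7 / 4 : ℝ)) := by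
    intro δt hδt
    have hδt0 : 0 < δt := hδ₁0.trans (hMid₁ hδt)
    have h1 : 0 < 1 + δt ^ 2 := by positivity
    have h := (le_div_iff₀ hW0).2 (hCstep δt hδt)
    have hrp : (1 + δt ^ 2)⁻¹ * (1 + δt ^ 2) ^ (1 / 8 : ℝ) ≤ δt ^ (-(7 / 4 : ℝ)) := by
      have e1 : (1 + δt ^ 2)⁻¹ * (1 + δt ^ 2) ^ (1 / 8 : ℝ) = (1 + δt ^ 2) ^ (-(7 / 8) : ℝ) := by
        rw [← Real.rpow_neg_one, ← Real.rpow_add h1]; norm_num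
      have e2 : δt ^ (-(7 / 4) : ℝ) = (δt ^ 2) ^ (-(7 / 8) : ℝ) := by
        rw [← Real.rpow_natCast δt 2, ← Real.rpow_mul hδt0.le]; norm_num
      rw [e1, e2]
      exact Real.rpow_le_rpow_of_nonpos (by positivity) (by nlinarith) (by norm_num)
    calc ((1 + δt ^ 2)⁻¹) ^ 2 * ∫ p in D, mbDensity (L := L) (hubAt δt 1) ε p ≤ ω * ((1 + δt ^ 2)⁻¹ * (1 + δt ^ 2) ^ (1 / 8 : ℝ)) * B / W := h
      _ = (ω * B / W) * ((1 + δt ^ 2)⁻¹ * (1 + δt ^ 2) ^ (1 / 8 : ℝ)) := by ring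
      _ ≤ (ω * B / W) * δt ^ (-(7 / 4 : ℝ)) := mul_le_mul_of_nonneg_left hrp (by positivity)
  have hIoi : IntegrableOn (fun δt : ℝ => (ω * B / W) * δt ^ (-(7 / 4 : ℝ))) (Ioi δ₁) := (integrableOn_Ioi_rpow_of_lt (by norm_num) hδ₁0).const_mul _
  have hmono2 : ∫ δ in Mid, ((1 + δ ^ 2)⁻¹) ^ 2 * ∫ p in D, mbDensity (L := L) (hubAt δ 1) ε p ≤ ∫ δ in Mid, (ω * B / W) * δ ^ (-(7 / 4 : ℝ)) := by
    refine integral_mono_of_nonneg ?_ (hIoi.mono_set hMid₁) ?_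
    · filter_upwards [ae_restrict_mem hMid] with δ hδ using mul_nonneg (by positivity) (integral_nonneg fun p => mbDensity_nonneg _ ε p)
    · filter_upwards [ae_restrict_mem hMid] with δ hδ using hpt2 δ hδ
  have hmono3 : ∫ δ in Mid, (ω * B / W) * δ ^ (-(7 / 4 : ℝ)) ≤ ∫ δ in Ioi δ₁, (ω * B / W) * δ ^ (-(7 / 4 : ℝ)) :=
    setIntegral_mono_set hIoi (by
      filter_upwards [ae_restrict_mem measurableSet_Ioi] with δ hδ
      exact mul_nonneg (by positivity) (Real.rpow_nonneg (hδ₁0.trans hδ).le _)) (Filter.Eventually.of_forall hMid₁)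
  have hval : ∫ δ in Ioi δ₁, (ω * B / W) * δ ^ (-(7 / 4 : ℝ)) = (ω * B / W) * ((4 / 3) * δ₁ ^ (-(3 / 4 : ℝ))) := by
    rw [integral_const_mul, integral_Ioi_rpow_of_lt (by norm_num) hδ₁0]
    congr 1
    rw [show (-(7 / 4 : ℝ) + 1) = -(3 / 4 : ℝ) by norm_num]; ring
  calc ∫ δ in Mid, ((1 + δ ^ 2)⁻¹) ^ 2 * ∫ p in D, mbDensity (L := L) (hubAt δ 1) ε p
      ≤ (ω * B / W) * ((4 / 3) * δ₁ ^ (-(3 / 4 : ℝ))) := (hmono2.trans hmono3).trans hval.le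
    _ = ω / W * ((4 / 3) * δ₁ ^ (-(3 / 4 : ℝ))) * B := by ring

end Summit.QuantumFields.YangMills.Theorems.SwapVirialDeficit.SectorLaplace

end
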